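import Literature.MathematicalPhysics.QuantumFieldTheory.Balaban1983to89.Beta.FluctuationProjection
import Summits.QuantumFields.BalabanUV.Beta.GAN24.QvOpSupLocality
import HarnessLib

/-!
# NE7StraightSliceB5AdjointSup — row NE7 (node U5), the (A)-bill's XL(c) docking, file D5 (vi″) of `t4/b2b-balaban-t4-ne7-p2/g84/XLC-DOCKING-MEMO.md` §9:
# `|Q*_k w|_∞ ≤ |w|_∞` (every fine bond lies on exactly `n` of the lines of (1.18)), HENCE THE GRADIENT SUP BOUND FOR `H_k = GQ*(QGQ*)⁻¹` REDUCES TO (1.115) FOR `G` AND A SUP BOUND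
# FOR `(QGQ*)⁻¹` — the last of the three displayed bounds of (149) is not independent

Lineage `b2b-balaban-t4-ne7-p2` (CRUX PROVER NE7 #2, co-owner of row NE7), generation 84.  ENTIRELY IN lit-balaban's SYMBOLS over the β sub-cell's `Beta.FluctuationProjection`
(`Hk = calG·QvAdj·(QGQ)⁻¹` (1.103), `QGQ`), `B5Block118` (`QvOp` (1.18)), `B5DeltaA169` (`QvAdj = n^d·Qᴴ`), and the G-an2-4 team's `Beta/GAN24/QvOpSupLocality`
(`sum_norm_QvOp_apply_le`: the column sums of `|Q_k|` are `≤ n^{-d}` — each fine bond lies on exactly `n` of the lines of (1.18)).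
WHAT ([folklore] counting; [cite: Balaban1984PropagatorsI, (1.18) p.20, (1.21) p.21, (1.103) p.34]).  §1 **`norm_QvAdj_mulVec_le`**: `|Q*_k w|_∞ ≤ |w|_∞` (`Q* = n^d·Qᴴ`, GAN24's column sums);
§2 **`curl_Hk_bound`**: from `hG1 : |∂_c(GJ)| ≤ C₁·|J|_∞` ((1.115) for `G`, gradient entry) and `hE : |(QGQ*)⁻¹B| ≤ C_E·|B|_∞` (B5's `𝒟⁻¹` in sup norm), `|∂_c(H_kB)| ≤ (C₁·C_E)·|B|_∞`
— so with (149) `curl_cSplit_bound` the (A)-bill's XL(c) is (1.115) for `G` (entries `|GJ|`, `|∇GJ|`, PROVED in lit-balaban on the torus family of record) plus ONE sup bound for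
`(QGQ*)⁻¹` on the unit torus (lit-balaban holds its uniform L² form (1.100)–(1.101) only) — memo §9 (d).
HONEST FRAMING (page 1): [folklore] counting on Bałaban's typed operators; NO estimate (two displayed hypotheses in §2); nothing of Bałaban's asserted; NOT (APE), NOT ONE-STEP, NOT NE7;
spine 0∕9; finite T⁴ rung (B)+1 — NOT infinite volume, NOT mass gap, NOT Clay.  Continuum YM on T⁴ ⇐ BetaPertH ∧ nine spine estimates (0/9 proved); BetaPertH ⇐ (D1) ∧ (D4) ∧
CAP+tail; G-an2-4 gates asym, D1 and NE2/3/4.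
-/

set_option autoImplicit false

open scoped BigOperators Matrix ComplexConjugate ComplexOrder
open Finset

namespace Summit.QuantumFields.BalabanUV.T4Continuum.NE7StraightSliceB5AdjointSup

open Literature.MathematicalPhysics.QuantumFieldTheory.Balaban1983to89
open B5Prop11Plancherel (Tor fine calG)
open B5Action121 (CurlOp)
open B5Block118 (QvOp)
open Summit.QuantumFields.BalabanUV.Beta.GAN24.QvOpSupLocality (sum_norm_QvOp_apply_le)
open B5DeltaA169 (QvAdj QvAdj_mulVec)
open Beta.FluctuationProjection (Hk QGQ)

noncomputable section

variable {d : ℕ} (n : ℕ) [NeZero n] (M : Fin d → ℕ) [hM : ∀ μ, NeZero (M μ)]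

/-! ## §1 `|Q*_k w|_∞ ≤ |w|_∞` -/

/-- **`|Q*_k w|_∞ ≤ |w|_∞`** (`Q*_k = n^d·(Q_k)ᴴ`; the column sums of `|Q_k|` are `≤ n^{-d}`, `GAN24.QvOpSupLocality.sum_norm_QvOp_apply_le`). [cite: Balaban1984PropagatorsI, (1.18) p.20, (1.21) p.21] -/
theorem norm_QvAdj_mulVec_le {w : Tor M × Fin d → ℂ} {g : ℝ} (hw : ∀ b, ‖w b‖ ≤ g) (i : Tor (fine n M) × Fin d) : ‖(QvAdj n M *ᵥ w) i‖ ≤ g := by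
  obtain ⟨x, μ⟩ := i
  have hg : 0 ≤ g := (norm_nonneg _).trans (hw (0, μ))
  have hn0 : (n : ℝ) ≠ 0 := by exact_mod_cast NeZero.ne n
  rw [QvAdj_mulVec, Pi.smul_apply, smul_eq_mul, norm_mul, norm_pow, Complex.norm_natCast]
  simp only [Matrix.mulVec, dotProduct, Matrix.conjTranspose_apply]
  calc (n : ℝ) ^ d * ‖∑ b, star (QvOp n M b (x, μ)) * w b‖
      ≤ (n : ℝ) ^ d * ∑ b, ‖QvOp n M b (x, μ)‖ * g := by
        refine mul_le_mul_of_nonneg_left ((norm_sum_le _ _).trans (Finset.sum_le_sum fun b _ => ?_)) (by positivity)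
        rw [norm_mul, norm_star]
        exact mul_le_mul_of_nonneg_left (hw b) (norm_nonneg _)
    _ = (n : ℝ) ^ d * g * ∑ b, ‖QvOp n M b (x, μ)‖ := by rw [← Finset.sum_mul]; ring
    _ ≤ (n : ℝ) ^ d * g * (1 / (n : ℝ) ^ d) := mul_le_mul_of_nonneg_left (sum_norm_QvOp_apply_le n M x μ) (by positivity)
    _ = g := by field_simp

/-! ## §2 The gradient sup bound for `H_k` from (1.115) for `G` and a sup bound for `(QGQ*)⁻¹` -/

/-- **`|∂_c(H_kB)| ≤ (C₁·C_E)·|B|_∞`** from `|∂_c(GJ)| ≤ C₁·|J|_∞` ((1.115) for `G`) and `|(QGQ*)⁻¹B| ≤ C_E·|B|_∞` (B5's `𝒟⁻¹` in sup norm): `H_kB = G(Q*((QGQ*)⁻¹B))` ((1.103))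
and `|Q*w|_∞ ≤ |w|_∞` (§1). [cite: Balaban1984PropagatorsI, (1.103) p.34, (1.115) p.36] -/
theorem curl_Hk_bound (hn : 1 ≤ n) (a : ℝ) (ha : 0 < a) (c : ℂ) {C₁ CE : ℝ}
    (hG1 : ∀ (J : Tor (fine n M) × Fin d → ℂ) (g : ℝ), (∀ p, ‖J p‖ ≤ g) → ∀ q, ‖(CurlOp (fine n M) c *ᵥ (calG n hn M a ha *ᵥ J)) q‖ ≤ C₁ * g)
    (hE : ∀ (B : Tor M × Fin d → ℂ) (g : ℝ), (∀ p, ‖B p‖ ≤ g) → ∀ p, ‖((QGQ n hn M a ha)⁻¹ *ᵥ B) p‖ ≤ CE * g)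
    (B : Tor M × Fin d → ℂ) (g : ℝ) (hB : ∀ p, ‖B p‖ ≤ g) (q : Tor (fine n M) × (Fin d × Fin d)) :
    ‖(CurlOp (fine n M) c *ᵥ (Hk n hn M a ha *ᵥ B)) q‖ ≤ (C₁ * CE) * g := by
  have e : Hk n hn M a ha *ᵥ B = calG n hn M a ha *ᵥ (QvAdj n M *ᵥ ((QGQ n hn M a ha)⁻¹ *ᵥ B)) := by
    rw [Beta.FluctuationProjection.Hk, ← Matrix.mulVec_mulVec, ← Matrix.mulVec_mulVec]
  rw [e]
  calc _ ≤ C₁ * (CE * g) := hG1 _ (CE * g) (fun i => norm_QvAdj_mulVec_le n M (hE B g hB) i) q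
    _ = (C₁ * CE) * g := by ring

end

end Summit.QuantumFields.BalabanUV.T4Continuum.NE7StraightSliceB5AdjointSup
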